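import Summits.QuantumFields.BalabanUV.Beta.GAN24.LinT2ZeroMode
import Summits.QuantumFields.BalabanUV.Beta.GAN24.ZeroModeFubiniTails

/-!
# `BalabanUV.Beta.GAN24.LinT2ZeroModeSlices` — binder row G-an2-4 / (CONV-C), W-slot road W3 (F2) (Z0) («T2-ZERO-MODE-KERNEL*», leaf-02 gen 15):
# THE TRANSPORTED FAMILY AS THE LEFT NEST, SUMMABILITY OF ITS THREE OUTER SLOTS, ADDITIVITY OF THE PERIOD-1 CHARGE

NOT IN PRINT; OUR BOOKKEEPING (G-an2-4 formalisation swarm, leaf seat `b2b-balaban-gan24-formalise-leaf-02`, gen 15; module name PROVISIONAL).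
HONEST FRAMING (cell contract, verbatim): «discharging `BetaPertH` makes Bałaban's UV stability UNCONDITIONAL — a real constructive-QFT result; it
is NOT the continuum limit and NOT the Clay problem.»  HONEST DEPENDENCY (verbatim): «continuum YM on T⁴ ⇐ BetaPertH ∧ nine spine estimates (0/9
proved); BetaPertH ⇐ (D1) ∧ (D4) ∧ CAP+tail; G-an2-4 gates asym, D1 and NE2/3/4.»  [folklore] lattice-sum bookkeeping over an2∕an4's DEFINED objects
BY NAME; cites nothing, mints no `def … : Prop`, instantiates no wall binder, asserts NO shape of Bałaban's tables; «T2Shape» ∕ «T2SupRate» stay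
LOCATED ∕ OPEN; discharges NOTHING of (hW, hWall); NOT «W-slot closed», NEVER «G-an2-4 closed»; NOT `BetaPertH`, NOT continuum, NOT Clay.

## What (generic `d`, blocking `N ≥ 1`) — the plumbing behind the charge of leaf-04's `T2RecursionAffine.lin4` (`GAN24/Lin4ZeroMode`)

* `linT2_eq_nested`: `linT2 K N T μ 0 ν y′ x′ z′ (inl α) (inl β)` IS the eight-slot tail of the LEFT nest of `ZeroModeSandwich.integrand` (the
  `push` step of `LinT2ZeroMode.zmode_one_linT2`, any table).
* `summable_linT2_slice₃∕₂∕₁`: for a decaying block kernel and a `LocStencil₂` table the three outer slots `z′`, `x′` (against `Σ'_{z′}`), `y′`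
  (against `Σ'_{x′} Σ'_{z′}`) of the transported family are summable (`ZeroModeFubiniTails.summable_nested₃∕₂∕₁` v1.1 on `summable_uncurryL_integrand`);
  `summable_linT2_swap_slices`: the same for the swapped family `linT2 K N T ν y′ μ 0` (coarse covariance `linT2_translate` + re-indexing).
* `zmode_one_add` (ADDITIVITY of `BiStencilZeroMode.zmode 1` under slice summability), `zmode_one_smul`, `zmode_one_neg` (unconditional).
-/

noncomputable section

open Finset
open scoped BigOperators
open Literature.MathematicalPhysics.QuantumFieldTheory
open Literature.MathematicalPhysics.QuantumFieldTheory.Balaban1983to89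
open Literature.MathematicalPhysics.QuantumFieldTheory.Balaban1983to89.Beta
open B12Sec2to5 (l1)
open ExpKernelCalculus (MKer Decays comp shiftK)
open OneStepResolventKernel (Fib wsum)
open OneStepKernelFamily (colH abs_colH_le vertexOfK)
open BalabanCompositeJets (LocStencil₂)
open SecondOrderResponse (vertex2OfK)
open BalabanStepJetsSucc (mmRead mmRead_inl_inl)
open Summit.QuantumFields.BalabanUV.Beta.GAN24.BiStencilZeroMode (Tab zmode zmode_one)
open Summit.QuantumFields.BalabanUV.Beta.GAN24.ZeroModeSandwich (integrand summable_uncurryL_integrand)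
open Summit.QuantumFields.BalabanUV.Beta.GAN24.LinT2ZeroMode (linT2 linT2_translate abs_le_of_locStencil₂)

namespace Summit.QuantumFields.BalabanUV.Beta.GAN24.LinT2ZeroModeSlices

variable {d N : ℕ} [NeZero N]

omit [NeZero N] in
/-- [folklore] **THE TRANSPORTED FAMILY UNFOLDS TO THE LEFT NEST** of `ZeroModeSandwich.integrand` (any table `T`; the `push` step of
`zmode_one_linT2` as a standalone identity). -/
theorem linT2_eq_nested (K : MKer (d + 1) (Fib d)) (T : Tab d) (μ ν α β : Fin (d + 1)) (y' x' z' : Fin (d + 1) → ℤ) :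
    linT2 K N T μ 0 ν y' x' z' (Sum.inl α) (Sum.inl β)
      = ∑' z, ∑ g, ∑' x, ∑ f, ∑ κ, ∑' u, ∑ κ', ∑' u',
          integrand (fun f x' x => K ((N : ℤ) • x') x (Sum.inr α) f) (fun κ u => colH K N μ 0 κ u) (fun κ' y' u' => colH K N ν y' κ' u')
            (fun f g κ κ' u u' x z => T κ u κ' u' x z f g) (fun g z z' => K z ((N : ℤ) • z') g (Sum.inr β)) y' x' z' z g x f κ u κ' u' := by
  simp only [linT2, mmRead_inl_inl, comp, vertex2OfK, vertexOfK, wsum, integrand]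
  refine tsum_congr fun z => Finset.sum_congr rfl fun g _ => ?_
  rw [← tsum_mul_right]
  refine tsum_congr fun x => ?_
  rw [Finset.sum_mul]
  refine Finset.sum_congr rfl fun f _ => ?_
  rw [Finset.mul_sum, Finset.sum_mul]
  refine Finset.sum_congr rfl fun κ _ => ?_
  rw [← tsum_mul_left, ← tsum_mul_right]
  refine tsum_congr fun u => ?_
  rw [Finset.mul_sum, Finset.mul_sum, Finset.sum_mul]
  refine Finset.sum_congr rfl fun κ' _ => ?_
  rw [← tsum_mul_left, ← tsum_mul_left, ← tsum_mul_right]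

/-- [folklore] The sandwich integrand of `linT2 K N T μ 0 ν` is summable on the eleven-slot product (decaying `K`, `LocStencil₂` table). -/
theorem summable_integrand_linT2 {K : MKer (d + 1) (Fib d)} {C m : ℝ} (hK : Decays K C m) (hm : 0 < m) {T : Tab d} {CT δ : ℝ}
    (hT : LocStencil₂ T CT δ) (hδ : 0 < δ) (μ ν α β : Fin (d + 1)) :
    Summable (ZeroModeFubini.uncurryL (integrand (fun f x' x => K ((N : ℤ) • x') x (Sum.inr α) f) (fun κ u => colH K N μ 0 κ u)
      (fun κ' y' u' => colH K N ν y' κ' u') (fun f g κ κ' u u' x z => T κ u κ' u' x z f g)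
      (fun g z z' => K z ((N : ℤ) • z') g (Sum.inr β)))) :=
  summable_uncurryL_integrand (N := N) (u₀ := (N : ℤ) • (0 : Fin (d + 1) → ℤ)) hm hδ
    (fun _ _ _ => hK _ _ _ _) (fun κ u => abs_colH_le hK μ 0 κ u) (fun κ' y' u' => abs_colH_le hK ν y' κ' u')
    (fun f g κ κ' u u' x z => abs_le_of_locStencil₂ hT κ u κ' u' x z f g) (fun _ _ _ => hK _ _ _ _)

/-- [folklore] **SUMMABILITY OF THE THREE OUTER SLOTS** of `(y′, x′, z′) ↦ linT2 K N T μ 0 ν y′ x′ z′ (inl α) (inl β)` (decaying block kernel,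
`LocStencil₂` table): the innermost slot `z′`, … -/
theorem summable_linT2_slice₃ {K : MKer (d + 1) (Fib d)} {C m : ℝ} (hK : Decays K C m) (hm : 0 < m) {T : Tab d} {CT δ : ℝ}
    (hT : LocStencil₂ T CT δ) (hδ : 0 < δ) (μ ν α β : Fin (d + 1)) (y' x' : Fin (d + 1) → ℤ) :
    Summable fun z' : Fin (d + 1) → ℤ => linT2 K N T μ 0 ν y' x' z' (Sum.inl α) (Sum.inl β) := by
  refine (ZeroModeFubiniTails.summable_nested₃ _ (summable_integrand_linT2 (N := N) hK hm hT hδ μ ν α β) y' x').congr ?_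
  intro v
  exact (linT2_eq_nested K T μ ν α β y' x' v).symm

/-- [folklore] … the middle slot `x′` (against the inner sum over `z′`), … -/
theorem summable_linT2_slice₂ {K : MKer (d + 1) (Fib d)} {C m : ℝ} (hK : Decays K C m) (hm : 0 < m) {T : Tab d} {CT δ : ℝ}
    (hT : LocStencil₂ T CT δ) (hδ : 0 < δ) (μ ν α β : Fin (d + 1)) (y' : Fin (d + 1) → ℤ) :
    Summable fun x' : Fin (d + 1) → ℤ => ∑' z', linT2 K N T μ 0 ν y' x' z' (Sum.inl α) (Sum.inl β) := by
  refine (ZeroModeFubiniTails.summable_nested₂ _ (summable_integrand_linT2 (N := N) hK hm hT hδ μ ν α β) y').congr ?_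
  intro v
  exact tsum_congr fun z' => (linT2_eq_nested K T μ ν α β y' v z').symm

/-- [folklore] … and the outer slot `y′` (against the inner double sum). -/
theorem summable_linT2_slice₁ {K : MKer (d + 1) (Fib d)} {C m : ℝ} (hK : Decays K C m) (hm : 0 < m) {T : Tab d} {CT δ : ℝ}
    (hT : LocStencil₂ T CT δ) (hδ : 0 < δ) (μ ν α β : Fin (d + 1)) :
    Summable fun y' : Fin (d + 1) → ℤ => ∑' x', ∑' z', linT2 K N T μ 0 ν y' x' z' (Sum.inl α) (Sum.inl β) := by
  refine (ZeroModeFubiniTails.summable_nested₁ _ (summable_integrand_linT2 (N := N) hK hm hT hδ μ ν α β)).congr ?_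
  intro v
  exact tsum_congr fun x' => tsum_congr fun z' => (linT2_eq_nested K T μ ν α β v x' z').symm

/-- [folklore] **ADDITIVITY OF THE PERIOD-1 CHARGE** for two coarse families whose `(μ, 0, ν, ·, ·, ·, a, b)` slots have summable outer three
slots (innermost, middle-against-inner, outer-against-double). -/
theorem zmode_one_add {F G : Tab d} {μ ν : Fin (d + 1)} {a b : Fib d}
    (hF₃ : ∀ y' x', Summable fun z' : Fin (d + 1) → ℤ => F μ 0 ν y' x' z' a b)
    (hF₂ : ∀ y', Summable fun x' : Fin (d + 1) → ℤ => ∑' z', F μ 0 ν y' x' z' a b)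
    (hF₁ : Summable fun y' : Fin (d + 1) → ℤ => ∑' x', ∑' z', F μ 0 ν y' x' z' a b)
    (hG₃ : ∀ y' x', Summable fun z' : Fin (d + 1) → ℤ => G μ 0 ν y' x' z' a b)
    (hG₂ : ∀ y', Summable fun x' : Fin (d + 1) → ℤ => ∑' z', G μ 0 ν y' x' z' a b)
    (hG₁ : Summable fun y' : Fin (d + 1) → ℤ => ∑' x', ∑' z', G μ 0 ν y' x' z' a b) :
    zmode 1 (F + G) μ ν a b = zmode 1 F μ ν a b + zmode 1 G μ ν a b := by
  rw [zmode_one, zmode_one, zmode_one, ← hF₁.tsum_add hG₁]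
  refine tsum_congr fun y' => ?_
  rw [← (hF₂ y').tsum_add (hG₂ y')]
  refine tsum_congr fun x' => ?_
  rw [← (hF₃ y' x').tsum_add (hG₃ y' x')]
  rfl

omit [NeZero N] in
/-- [folklore] The period-1 charge is homogeneous (unconditional). -/
theorem zmode_one_smul (c : ℝ) (F : Tab d) (μ ν : Fin (d + 1)) (a b : Fib d) :
    zmode 1 (c • F) μ ν a b = c * zmode 1 F μ ν a b := by
  rw [zmode_one, zmode_one]
  simp only [Pi.smul_apply, smul_eq_mul, tsum_mul_left]

omit [NeZero N] in
/-- [folklore] The period-1 charge of a negated family (unconditional). -/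
theorem zmode_one_neg (F : Tab d) (μ ν : Fin (d + 1)) (a b : Fib d) :
    zmode 1 (-F) μ ν a b = -zmode 1 F μ ν a b := by
  rw [zmode_one, zmode_one]
  simp only [Pi.neg_apply, tsum_neg]

/-- [folklore] **SUMMABILITY OF THE SWAPPED FAMILY's three outer slots** (from the unswapped ones with `μ ↔ ν`, by coarse covariance and
re-indexing). -/
theorem summable_linT2_swap_slices {K : MKer (d + 1) (Fib d)} {C m : ℝ} (hK : Decays K C m) (hm : 0 < m)
    (hKcov : ∀ t, shiftK (-((N : ℤ) • t)) K = K) {T : Tab d} {CT δ : ℝ} (hT : LocStencil₂ T CT δ) (hδ : 0 < δ)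
    (hTcov : ∀ κ u κ' u' t, T κ (u + (N : ℤ) • t) κ' (u' + (N : ℤ) • t) = shiftK (-((N : ℤ) • t)) (T κ u κ' u')) (μ ν α β : Fin (d + 1)) :
    (∀ y' x', Summable fun z' : Fin (d + 1) → ℤ => linT2 K N T ν y' μ 0 x' z' (Sum.inl α) (Sum.inl β))
      ∧ (∀ y', Summable fun x' : Fin (d + 1) → ℤ => ∑' z', linT2 K N T ν y' μ 0 x' z' (Sum.inl α) (Sum.inl β))
      ∧ Summable fun y' : Fin (d + 1) → ℤ => ∑' x', ∑' z', linT2 K N T ν y' μ 0 x' z' (Sum.inl α) (Sum.inl β) := by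
  -- coarse covariance: `linT2 … ν y′ μ 0 x′ z′ = linT2 … ν 0 μ (−y′) (x′ − y′) (z′ − y′)`
  have e : ∀ y' x' z' : Fin (d + 1) → ℤ, linT2 K N T ν y' μ 0 x' z' (Sum.inl α) (Sum.inl β)
      = linT2 K N T ν 0 μ (-y') (x' + -y') (z' + -y') (Sum.inl α) (Sum.inl β) := by
    intro y' x' z'
    have h := linT2_translate hKcov hTcov ν 0 μ (-y') y'
    rw [zero_add, neg_add_cancel] at h
    rw [h]
    simp only [shiftK]
  refine ⟨fun y' x' => ?_, fun y' => ?_, ?_⟩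
  · simp_rw [e]
    exact ((summable_linT2_slice₃ hK hm hT hδ ν μ α β (-y') (x' + -y')).comp_injective
      (Equiv.addRight (-y')).injective).congr fun z' => rfl
  · simp_rw [e]
    have h3 : ∀ x', (∑' z', linT2 K N T ν 0 μ (-y') (x' + -y') (z' + -y') (Sum.inl α) (Sum.inl β))
        = ∑' z', linT2 K N T ν 0 μ (-y') (x' + -y') z' (Sum.inl α) (Sum.inl β) := fun x' =>
      (Equiv.addRight (-y')).tsum_eq (fun z' => linT2 K N T ν 0 μ (-y') (x' + -y') z' (Sum.inl α) (Sum.inl β))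
    simp_rw [h3]
    exact ((summable_linT2_slice₂ hK hm hT hδ ν μ α β (-y')).comp_injective (Equiv.addRight (-y')).injective).congr fun x' => rfl
  · simp_rw [e]
    have h23 : ∀ y', (∑' x', ∑' z', linT2 K N T ν 0 μ (-y') (x' + -y') (z' + -y') (Sum.inl α) (Sum.inl β))
        = ∑' x', ∑' z', linT2 K N T ν 0 μ (-y') x' z' (Sum.inl α) (Sum.inl β) := by
      intro y'
      rw [← (Equiv.addRight (-y')).tsum_eq (fun x' => ∑' z', linT2 K N T ν 0 μ (-y') x' z' (Sum.inl α) (Sum.inl β))]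
      refine tsum_congr fun x' => ?_
      exact (Equiv.addRight (-y')).tsum_eq (fun z' => linT2 K N T ν 0 μ (-y') (x' + -y') z' (Sum.inl α) (Sum.inl β))
    simp_rw [h23]
    exact ((summable_linT2_slice₁ hK hm hT hδ ν μ α β).comp_injective (Equiv.neg (Fin (d + 1) → ℤ)).injective).congr fun y' => rfl

end Summit.QuantumFields.BalabanUV.Beta.GAN24.LinT2ZeroModeSlices
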